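import Summits.ResolutionOfSingularities.ResolutionOfSingularities.Theorems.PurelyInseparableDim4JointChartNormalise
import HarnessLib

/-!
# Purely inseparable four-folds: NO TRANSVERSAL CHILD over a covering member — the HONEST SCOPE of the monotone joint forest,
# sharpened (brick S3 (c) «joint point∘coordinate chains», part 26, cell `res-dim4-pi`)

[OURS · counted 0] (D-0157 DOOR 2; desk WORD #66 (4)(c), #74 (g), #99 (d); frame `PIDim4.TerminationImpliesOrderReduction`,
S3 (c); host item stmt-ResolutionOfSingularities-16155, helper). Nothing here proves resolution of singularities in
dimension ≥ 4 / characteristic `p` — NOT here, not anywhere in this programme.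

The joint forest (v2, normalised cover p683579) plans children `(j, b, S″)` with `S ⊆ S″` — coordinate centres INSIDE the new
exceptional component `E_j`. The walk's other non-escaping centres have `S ∖ {j} ⊆ S″` but `j ∉ S″`: TRANSVERSAL to `E_j` (typ-2 g4's
`globalCentre_admissible_package_of_not_mem` makes them admissible). This file shows they CANNOT OCCUR in the forest's setting:

* **`no_transversal_child`** — `K = K̄` of characteristic `p`; `F` with `p ≤ ord_{(x_S)} F` whose closed order-`p` points ALL lie on
  `V(z, x_S)` (the root member carries every root parameter); `j ∈ S`, `b_j = 0`, `S′ ∌ j`. Then `V(z, x_{S′})` is NOT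
  Hironaka-permissible for the child state `step p S j b (F, 0, ∅)`, i.e. `¬ p ≤ ord_{(x_{S′})} (step …).F`. PROOF: on typ-2's
  re-centred `x_j`-chart of a blow-up of `𝔸⁵` along `V(z, x_S)` the rational point `z̃ = 0`, `x_i = 0 (i ∈ S′)`, `x_j = 1` of
  `V(z̃, x_{S′})` has order `≥ p` for the transform, lies OFF the exceptional divisor (`x_j = 1`), hence over an order-`p` point of
  `z^p + F` with `x_j`-coordinate `1 ≠ 0` — off `V(z, x_S)`, contradiction.

CONSEQUENCE for the HONEST SCOPE of S3 (c) joint v2: with the normalised cover, the forest handles EVERY non-escaping child of the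
frame; what remains outside is exactly (i) escaping children inside `E_j` (`j ∈ S″`, `S ⊄ S″`; typ-2 g4's Q1–Q3) and
(ii) configurations whose order-`p` locus has intersecting components (no disjoint covering members at the root), where
transversal children = strict transforms of WAITING components do occur (design memo `S3c-V3-DESIGN.md`).
AI-produced formalisation, weaker than expert review. bears_on: LADDER-RESOLUTION:D157-DOOR2 (res-dim4-pi · S3 (c) joint v2 · scope).
-/

set_option linter.dupNamespace false -- D-0017: single-problem summit path `Summit.<S>.<S>.…` by design

noncomputable section

open MvPolynomial Finset CategoryTheory AlgebraicGeometry Opposite TopologicalSpace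
open AlgebraicGeometry.Scheme.IdealSheafData (ofIdealTop vanishingIdeal)

namespace Summit.ResolutionOfSingularities.ResolutionOfSingularities.Theorems.PIDim4

open Literature.AlgebraicGeometry.Resolution
open Literature.AlgebraicGeometry.Resolution.Hauser2010
open Literature.AlgebraicGeometry.Resolution.AffinePointBlowup (P A γ coord Wtop ξ)

namespace Equimultiple

section NoTransversal

variable {K : Type} [Field K] {p : ℕ} [hp : Fact p.Prime] [CharP K p]

/-- A `K`-algebra endomorphism of `K[X]` composed with a chart substitution is the evaluation at its values on the variables;
`Spec` of it sends the rational point `w` to the rational point of those values at `w`. [folklore] -/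
theorem specMap_comp_apply_pt (Ψ : A 4 K →ₐ[K] A 4 K) (w : Fin (4 + 1) → K) (y : P 4 K)
    (hy : y.asIdeal = MvPolynomial.vanishingIdeal K {w}) :
    ((Spec.map (CommRingCat.ofHom Ψ.toRingHom)) y).asIdeal =
      MvPolynomial.vanishingIdeal K {(fun m => aeval w (Ψ (X m)) : Fin (4 + 1) → K)} := by
  have hΨ : Ψ = aeval (fun m => Ψ (X m)) := MvPolynomial.aeval_unique Ψ
  have hΨr : CommRingCat.ofHom Ψ.toRingHom =
      CommRingCat.ofHom (aeval (fun m => Ψ (X m)) : A 4 K →ₐ[K] A 4 K).toRingHom := by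
    rw [← hΨ]
  rw [hΨr, ChartDictionary.specMap_aeval_apply_pt]
  exact hy

/-- **NO TRANSVERSAL CHILD OVER A COVERING MEMBER.** See the module docstring.
[cite: Hauser2010, §F (equiconstant points)] [cite: GortzWedhorn2020, Prop. 13.91 (3) (a blow-up is an isomorphism off its centre)]
[cite: HauserPerlega2019PRIMS, §2 (permissible centres P = (z, x_i : i ∈ Γ))] -/
theorem no_transversal_child [IsAlgClosed K] [DecidableEq K] (F : MvPolynomial (Fin 4) K) {S : Finset (Fin 4)}
    (hperm : (p : ℕ∞) ≤ CentreBlowup.ordAlong S F)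
    (hroots : ∀ b' : Fin 4 → K, (∀ d : Fin 4 →₀ ℕ, d ≠ 0 → d.degree < p → coeff d (PointBlowup.translate b' F) = 0) →
      ∀ i ∈ S, b' i = 0)
    {j : Fin 4} (hj : j ∈ S) (b : Fin 4 → K) (hbj : b j = 0) {S' : Finset (Fin 4)} (hjS' : j ∉ S') :
    ¬ (p : ℕ∞) ≤ CentreBlowup.ordAlong S' (CentreBlowup.step p S j b (⟨F, 0, ∅⟩ : State K)).F := by
  classical
  intro hperm'
  haveI : PerfectRing K p := PerfectRing.ofSurjective K p fun x => IsAlgClosed.exists_pow_nat_eq x hp.out.pos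
  set Λ : Set (Fin (4 + 1)) := insert 0 (Fin.succ '' (S : Set (Fin 4))) with hΛ
  set B := blowup.π (AffineCoordBlowup.𝓘Λ 4 K Λ) with hBdef
  have hB : IsBlowup B (AffineCoordBlowup.𝓘Λ 4 K Λ) := blowup.isBlowup _
  obtain ⟨Θ, h, h0, hs, hc⟩ :=
    ChartDictionary.controlledTransform_chart_eq_step p hj hbj (⟨F, 0, ∅⟩ : State K) hperm hB
  haveI := isOpenImmersion_specMap_algEquiv Θ
  -- the rational point `z̃ = 0`, `x_i = 0` (`i ≠ j`), `x_j = 1` of the cleaned chart lies on `V(z̃, x_{S'})`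
  let c : Fin 4 → K := fun i => if i = j then 1 else 0
  have hcj : c j = 1 := if_pos rfl
  have hcS' : ∀ i ∈ S', c i = 0 := fun i hi => by
    have hij : i ≠ j := fun h' => hjS' (h' ▸ hi)
    exact if_neg hij
  let y : P 4 K := ⟨MvPolynomial.vanishingIdeal K {(Fin.cons 0 c : Fin (4 + 1) → K)}, inferInstance⟩
  have hyC : y ∈ AffineCoordBlowup.CΛ 4 K (insert 0 (Fin.succ '' (S' : Set (Fin 4)))) := mem_CΛ_of_cons rfl rfl hcS'
  -- order ≥ p there for the transform
  have h1 : (p : ℕ∞) ≤ idealOrder (hypSheaf p (CentreBlowup.step p S j b (⟨F, 0, ∅⟩ : State K)).F) y :=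
    ChartDictionary.le_idealOrder_hypSheaf_of_mem_CΛ p S' _ hperm' hyC
  rw [← hc, idealOrder_comap_of_isOpenImmersion] at h1
  -- the point lies OFF the exceptional divisor: `x_j + b_j` does not vanish at it
  set r : P 4 K := Spec.map (CommRingCat.ofHom (Θ : A 4 K →+* A 4 K)) y with hr
  have hXj : (X j.succ : A 4 K) ∉ r.asIdeal := by
    rw [hr, Spec.map_apply, PrimeSpectrum.comap_asIdeal, Ideal.mem_comap, CommRingCat.hom_ofHom]
    change Θ (X j.succ) ∉ MvPolynomial.vanishingIdeal K {(Fin.cons 0 c : Fin (4 + 1) → K)}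
    rw [hs j, MvPolynomial.mem_vanishingIdeal_singleton_iff, map_add, aeval_X, aeval_C, Fin.cons_succ, hcj, hbj]
    simp
  have hnot : B (AffineCoordBlowup.chartImm hB (ChartDictionary.succ_mem_centreVars hj) r) ∉
      ((AffineCoordBlowup.𝓘Λ 4 K Λ).support : Set (P 4 K)) := by
    rw [AffineCoordBlowup.support_𝓘Λ]
    exact fun hmem => hXj ((π_chartImm_mem_CΛ_iff hB hj r).mp hmem)
  -- hence its image in `𝔸⁵` is an order-`p` point of `z^p + F` …
  have h2 : (p : ℕ∞) ≤ idealOrder (hypSheaf p F) (B (AffineCoordBlowup.chartImm hB (ChartDictionary.succ_mem_centreVars hj) r)) := by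
    rw [← idealOrder_controlledTransform_eq_of_eq_of_not_mem_support hB hnot (hypSheaf p F) p rfl]
    exact h1
  -- … with coordinates: `x_j = 1`
  set Ψ : A 4 K →ₐ[K] A 4 K := (Θ : A 4 K →ₐ[K] A 4 K).comp (coordBlowupSubst K Λ j.succ) with hΨ
  have hcomp : Spec.map (CommRingCat.ofHom (Θ : A 4 K →+* A 4 K)) ≫
      AffineCoordBlowup.chartImm hB (ChartDictionary.succ_mem_centreVars hj) ≫ B = Spec.map (CommRingCat.ofHom Ψ.toRingHom) := by
    rw [AffineCoordBlowup.chartImm_comp, ← Spec.map_comp, ← CommRingCat.ofHom_comp]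
    rfl
  set u : Fin (4 + 1) → K := fun m => aeval (Fin.cons 0 c : Fin (4 + 1) → K) (Ψ (X m)) with hu
  have hBw : (B (AffineCoordBlowup.chartImm hB (ChartDictionary.succ_mem_centreVars hj) r)).asIdeal =
      MvPolynomial.vanishingIdeal K {(Fin.cons (u 0) (fun i => u i.succ) : Fin (4 + 1) → K)} := by
    have hpt : B (AffineCoordBlowup.chartImm hB (ChartDictionary.succ_mem_centreVars hj) r) =
        (Spec.map (CommRingCat.ofHom Ψ.toRingHom)) y := by
      rw [hr, ← Scheme.Hom.comp_apply, ← Scheme.Hom.comp_apply, ← hcomp]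
    rw [hpt, specMap_comp_apply_pt Ψ (Fin.cons 0 c) y rfl]
    congr 2
    funext m
    refine Fin.cases rfl (fun i => rfl) m
  have huj : u j.succ = 1 := by
    rw [hu]
    change aeval (Fin.cons 0 c : Fin (4 + 1) → K) (Θ (coordBlowupSubst K Λ j.succ (X j.succ))) = 1
    rw [coordBlowupSubst_X_self, hs j, map_add, aeval_X, aeval_C, Fin.cons_succ, hcj, hbj]
    simp
  -- contradiction with «all root parameters lie on the member»
  have hord := (natCast_le_idealOrder_hypSheaf_iff (p := p) F hBw p).mp h2
  rw [natCast_le_ordZero_translate_hyp_iff] at hord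
  have := hroots (fun i => u i.succ) hord.2 j hj
  rw [huj] at this
  exact one_ne_zero this

end NoTransversal

end Equimultiple

end Summit.ResolutionOfSingularities.ResolutionOfSingularities.Theorems.PIDim4

end
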